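import Mathlib
import HarnessLib
import Summits.HubbardSuperconductivity.HubbardSuperconductivity.Theorems.KLProgrammeKLRegimeEngineTowerModelDefsRate
import Summits.HubbardSuperconductivity.HubbardSuperconductivity.Theorems.KLProgrammeKLRegimeEnginePlaneWavePhases

/-!
# Route `KLProgramme` — ENGINE child gen 8 (stmt-HubbardSuperconductivity-20437 `KLRegimeEngineV17F2`), stub (b) conj. 4 / class #7 currency:
# THE DOOR FROM THE TOWER'S WEIGHTED SECTOR-PINNED SUMS TO THE SECTOR-PINNED TWO-LEG MOMENT CLAUSES
# (cell gate-hubbard-kl, seat hubbard-kl-k3c2-p3 g9, W3 lane; plan g20 (R72) leaf (N): supplier = E1 «part 10-L» in its own carrier `klWtPinnedSumAt`)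

WHAT.  The sector-pinned per-increment class-#7 atom (W3, `TwoLegSectorIncrementAt`, text-in-waiting) reads, for a Grassmann element `T`
(an increment of the flow), the anisotropic family `F_J = klAnisoFamily … K klE0 J`, a spin `σ`, a pinned sector `ω` and a pinned point `x₀`,
  (time)  `ε Σ_{x : x 0 = x₀} Σ_{ω′} ε·circDist_{2M}(t₀,t₁) · ‖W^{F_J}_{2,((ω,σ),+),((ω′,σ),−)}(T)(x)‖`,
  (space) `ε Σ_{x : x 0 = x₀} Σ_{ω′} (|Δx̃₀| + |Δx̃₁|) · ‖W^{F_J}_{2,((ω,σ),+),((ω′,σ),−)}(T)(x)‖`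
(`W^{F} = sectorisedKernel … F T 2`, `ε = imagTimeWeight β M`).  The levels tower (E1) measures two-leg kernels in the carrier
`klWtPinnedSumAt L M β μ K J j 2 T 0 w` (`…EngineTowerModelDefsRate`): family `F_J`, leg `0` pinned at `w = (x₀, ℓ₀)`, leg `1` summed over positions
AND labels, tree weight `klScaleWt L M β j = 1 + Λ_j·diam` of RATE `j`.  This file is the conversion, for ANY `T`, `J`, `j`:

* §1 geometry of a lattice two-string `X`: `ε·circDist_{2M}(t₀,t₁) ≤ spaceTimeDist`, `|Δx̃_b| ≤ spaceTimeDist`, hence (with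
  `klScale_mul_spaceTimeDist_le_klScaleWt_image_sub_one`) the atom's time weight is `≤ Λ_j⁻¹·(klScaleWt_j − 1)` and its space weight is
  `≤ 2Λ_j⁻¹·(klScaleWt_j − 1)` — the `− 1` form: both atom weights VANISH on the diagonal, so the diagonal of the weighted sum is never charged;
* §2 the fibre domination `sum_sector_string_le_sum_pinned` (the strings `(x, ω′) ↦ X` inject into the pinned fibre `{X : X 0 = (x₀, ((ω,σ),+))}`);
* §3 **the rows**: if the `(klScaleWt_j − 1)`-weighted sector-pinned sum of `‖kernel (map (toLin' E(F_J)) T) 2 ·‖` over the fibre is `≤ B`, then the time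
  expression is `≤ Λ_j⁻¹·B` and the space expression is `≤ 2Λ_j⁻¹·B` (`sectorTimeMoment_le_of_wtSubOne_pinnedSum`, `sectorSpaceMoment_le_of_wtSubOne_pinnedSum`);
  the same from the tower's carrier `klWtPinnedSumAt L M β μ K J j 2 T 0 (x₀, ((ω,σ),+)) ≤ B` (`…_of_klWtPinnedSumAt`), since `klScaleWt − 1 ≤ klScaleWt`.
So a supplier bound `klWtPinnedSumAt … J j 2 (Δ) 0 (x₀,((ω,σ),+)) ≤ b·U²` at `J = s_n(j′)` gives the increment atom's two clauses with
`bt = Λ_j⁻¹·b`, `bs = 2Λ_j⁻¹·b` — by name, no unfolding on the supplier side.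
* §4 (appended, pen (R81b)) the FIXED-TUPLE first-moment door, any family / degree / rate: `fixedTuple_firstMoment_le_of_wtSubOne` / `_of_wt`, and route (M)'s
  M2 literal shape `klIso_firstMoment_le_of_wt` (iso quartic of `𝒱_n[K]` at every resolution `m`, weight rate `m`).
Inequalities with explicit hypotheses; nothing about the model is asserted; nothing asserts superconductivity.
References: BGM 2006 §2.4 (2.36), §3 (3.5)–(3.6) (the `sup_{ω̄}` read-out of `∂_{k₀}Σ`) [cite: BenfattoGiulianiMastropietro2006].
-/

noncomputable section

namespace Summit.HubbardSuperconductivity.HubbardSuperconductivity.Theorems.EngineV8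

set_option linter.dupNamespace false -- summit = problem name (single-conjunct summit), D-0017

open Real Finset Literature.MathematicalPhysics.QuantumLattice Literature.Probability.LatticeModels GrassmannAlgebra
open Summit.HubbardSuperconductivity.HubbardSuperconductivity.Theorems.KLRegimeSplit
open Summit.HubbardSuperconductivity.HubbardSuperconductivity.Theorems.KLProgrammeLegKernels

variable {L M : ℕ} [NeZero L] [NeZero M]

/-! ## §1 Geometry of a lattice two-string -/

omit [NeZero L] [NeZero M] in
/-- The atom's time weight is at most the space-time distance of the two legs: `ε·circDist_{2M}(t₀,t₁) ≤ spaceTimeDist x y`. -/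
theorem timeWeight_le_spaceTimeDist (β : ℝ) (x y : SpaceTimeIdx L M) :
    imagTimeWeight β M * (circDist (2 * M) x.1.val y.1.val : ℝ) ≤ KLRegimeSplit.spaceTimeDist L M β x y :=
  le_max_left _ _

omit [NeZero M] in
/-- A centred coordinate difference is at most the space-time distance: `|((x⃗ − y⃗) b)~| ≤ spaceTimeDist x y`. -/
theorem abs_valMinAbs_sub_le_spaceTimeDist (β : ℝ) (x y : SpaceTimeIdx L M) (b : Fin 2) :
    |((((x.2 - y.2) b).valMinAbs : ℤ) : ℝ)| ≤ KLRegimeSplit.spaceTimeDist L M β x y := by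
  rw [Pi.sub_apply, ← circDist_val_cast_eq_abs_valMinAbs]
  refine le_trans ?_ (le_max_right _ _)
  fin_cases b
  · exact le_max_left _ _
  · exact le_max_right _ _

omit [NeZero M] in
/-- The atom's space weight is at most twice the space-time distance: `|Δx̃₀| + |Δx̃₁| ≤ 2·spaceTimeDist x y`. -/
theorem spaceWeight_le_two_mul_spaceTimeDist (β : ℝ) (x y : SpaceTimeIdx L M) :
    |((((x.2 - y.2) 0).valMinAbs : ℤ) : ℝ)| + |((((x.2 - y.2) 1).valMinAbs : ℤ) : ℝ)| ≤ 2 * KLRegimeSplit.spaceTimeDist L M β x y := by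
  have h0 := abs_valMinAbs_sub_le_spaceTimeDist (L := L) (M := M) β x y 0
  have h1 := abs_valMinAbs_sub_le_spaceTimeDist (L := L) (M := M) β x y 1
  linarith

/-- **The time weight of a lattice two-string is dominated by `Λ_j⁻¹·(klScaleWt_j − 1)`** of its position set (`0 ≤ β`). -/
theorem timeWeight_le_klScale_inv_mul_klScaleWt_sub_one {β : ℝ} (hβ : 0 ≤ β) (j : ℕ) {Ns : ℕ}
    (X : Fin 2 → SpaceTimeIdx L M × SectorLeg Ns) :
    imagTimeWeight β M * (circDist (2 * M) (X 0).1.1.val (X 1).1.1.val : ℝ) ≤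
      (klScale klE0 j)⁻¹ * (klScaleWt L M β j ((univ.image X).image (latticeLegPos (2 * (2 * M)))) - 1) := by
  have hΛ := klth_klScale_pos j
  have h := klScale_mul_spaceTimeDist_le_klScaleWt_image_sub_one (L := L) (M := M) hβ j X 0 1
  rw [le_inv_mul_iff₀' hΛ]
  calc imagTimeWeight β M * (circDist (2 * M) (X 0).1.1.val (X 1).1.1.val : ℝ) * klScale klE0 j
      = klScale klE0 j * (imagTimeWeight β M * (circDist (2 * M) (X 0).1.1.val (X 1).1.1.val : ℝ)) := by ring
    _ ≤ klScale klE0 j * KLRegimeSplit.spaceTimeDist L M β (X 0).1 (X 1).1 :=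
        mul_le_mul_of_nonneg_left (timeWeight_le_spaceTimeDist β _ _) hΛ.le
    _ ≤ _ := h

/-- **The space weight of a lattice two-string is dominated by `2Λ_j⁻¹·(klScaleWt_j − 1)`** of its position set (`0 ≤ β`). -/
theorem spaceWeight_le_two_mul_klScale_inv_mul_klScaleWt_sub_one {β : ℝ} (hβ : 0 ≤ β) (j : ℕ) {Ns : ℕ}
    (X : Fin 2 → SpaceTimeIdx L M × SectorLeg Ns) :
    |(((((X 0).1.2 - (X 1).1.2) 0).valMinAbs : ℤ) : ℝ)| + |(((((X 0).1.2 - (X 1).1.2) 1).valMinAbs : ℤ) : ℝ)| ≤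
      2 * ((klScale klE0 j)⁻¹ * (klScaleWt L M β j ((univ.image X).image (latticeLegPos (2 * (2 * M)))) - 1)) := by
  have hΛ := klth_klScale_pos j
  have h := klScale_mul_spaceTimeDist_le_klScaleWt_image_sub_one (L := L) (M := M) hβ j X 0 1
  have h2 := spaceWeight_le_two_mul_spaceTimeDist (L := L) (M := M) β (X 0).1 (X 1).1
  have h3 : KLRegimeSplit.spaceTimeDist L M β (X 0).1 (X 1).1 ≤
      (klScale klE0 j)⁻¹ * (klScaleWt L M β j ((univ.image X).image (latticeLegPos (2 * (2 * M)))) - 1) := by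
    rw [le_inv_mul_iff₀' hΛ, mul_comm]; exact h
  linarith

omit [NeZero L] [NeZero M] in
/-- `klScaleWt − 1 ≤ klScaleWt`-type comparison of the two weighted sums' integrands: `(w − 1)·a ≤ w·a` for `0 ≤ a`. -/
theorem klScaleWt_sub_one_mul_le (β : ℝ) (j : ℕ) (S : Finset (ZMod (2 * (2 * M)) × TorusSite 2 L)) {a : ℝ} (ha : 0 ≤ a) :
    (klScaleWt L M β j S - 1) * a ≤ klScaleWt L M β j S * a := by
  nlinarith

/-! ## §2 The sector strings inject into the pinned fibre -/

omit [NeZero M] in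
/-- **The atom's double sum is dominated by the pinned fibre sum**: for `f ≥ 0`, a spin `σ`, a pinned label `ω`, a pinned point `x₀`,
`Σ_{x : x 0 = x₀} Σ_{ω′} f (i ↦ (x i, [((ω,σ),+), ((ω′,σ),−)] i)) ≤ Σ_{X : X 0 = (x₀, ((ω,σ),+))} f X`. -/
theorem sum_sector_string_le_sum_pinned {Ns : ℕ} (f : (Fin 2 → SpaceTimeIdx L M × SectorLeg Ns) → ℝ) (hf : ∀ X, 0 ≤ f X)
    (σ : Fin 2) (ω : Fin Ns) (x₀ : SpaceTimeIdx L M) :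
    ∑ x ∈ (univ : Finset (Fin 2 → SpaceTimeIdx L M)).filter (fun x => x 0 = x₀), ∑ ω' : Fin Ns,
        f (fun i => (x i, (![((ω, σ), 0), ((ω', σ), 1)] : Fin 2 → SectorLeg Ns) i)) ≤
      ∑ X ∈ univ.filter (fun X : Fin 2 → SpaceTimeIdx L M × SectorLeg Ns => X 0 = (x₀, ((ω, σ), 0))), f X := by
  classical
  set emb : (Fin 2 → SpaceTimeIdx L M) × Fin Ns → (Fin 2 → SpaceTimeIdx L M × SectorLeg Ns) :=
    fun p i => (p.1 i, (![((ω, σ), 0), ((p.2, σ), 1)] : Fin 2 → SectorLeg Ns) i) with hemb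
  have hinj : Function.Injective emb := by
    rintro ⟨x, η⟩ ⟨y, η'⟩ h
    have h0 := congrFun h 0
    have h1 := congrFun h 1
    simp only [hemb, Matrix.cons_val_zero, Matrix.cons_val_one, Matrix.cons_val_fin_one, Prod.mk.injEq] at h0 h1
    have hxy : x = y := by
      funext i
      fin_cases i
      · exact h0.1
      · exact h1.1
    cases hxy
    have hη : η = η' := h1.2.1.1
    cases hη
    rfl
  rw [← sum_product' (f := fun x ω' => f (emb (x, ω'))), ← sum_image (f := f) fun p _ q _ h => hinj h]
  refine sum_le_sum_of_subset_of_nonneg ?_ fun X _ _ => hf X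
  intro X hX
  obtain ⟨⟨x, ω'⟩, hp, rfl⟩ := mem_image.1 hX
  rw [mem_product] at hp
  have hx0 : x 0 = x₀ := (mem_filter.1 hp.1).2
  exact mem_filter.2 ⟨mem_univ _, by simp [hemb, hx0]⟩

/-! ## §3 The rows -/

section Rows

variable {β μ : ℝ} {K : TrigPolyC4v} {J j : ℕ} {T : HubbardGrassmann L M} {σ : Fin 2} {ω : Fin (sectorCount J)} {x₀ : SpaceTimeIdx L M} {B : ℝ}

omit [NeZero M] in
/-- The analysed kernel on a sector string is the sectorised kernel of the atom. -/
theorem kernel_map_sectorAnalysis_string (β : ℝ) (μ : ℝ) (K : TrigPolyC4v) (J : ℕ) (T : HubbardGrassmann L M) (σ : Fin 2)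
    (ω ω' : Fin (sectorCount J)) (x : Fin 2 → SpaceTimeIdx L M) :
    kernel ℂ (ExteriorAlgebra.map (Matrix.toLin' (sectorAnalysisMatrix L M β (klAnisoFamily L M β μ K klE0 J))) T) 2
        (fun i => (x i, (![((ω, σ), 0), ((ω', σ), 1)] : Fin 2 → SectorLeg (sectorCount J)) i)) =
      sectorisedKernel L M β (klAnisoFamily L M β μ K klE0 J) T 2
        (![((ω, σ), 0), ((ω', σ), 1)] : Fin 2 → SectorLeg (sectorCount J)) x := by
  rw [kernel_map_sectorAnalysis]

/-- **TIME ROW FROM THE `(klScaleWt_j − 1)`-WEIGHTED SECTOR-PINNED SUM** (`0 ≤ β`; any `T`, family `F_J`, rate `j`): if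
`ε Σ_{X : X 0 = (x₀,((ω,σ),+))} (klScaleWt_j(pos X) − 1)·‖kernel (map E(F_J) T) 2 X‖ ≤ B` then the atom's time expression at `(σ, ω, x₀)` is `≤ Λ_j⁻¹·B`.
[cite: BenfattoGiulianiMastropietro2006, §3 (3.5)-(3.6)] -/
theorem sectorTimeMoment_le_of_wtSubOne_pinnedSum (hβ : 0 ≤ β)
    (hB : imagTimeWeight β M *
      ∑ X ∈ univ.filter (fun X : Fin 2 → SpaceTimeIdx L M × SectorLeg (sectorCount J) => X 0 = (x₀, ((ω, σ), 0))),
        (klScaleWt L M β j ((univ.image X).image (latticeLegPos (2 * (2 * M)))) - 1) *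
          ‖kernel ℂ (ExteriorAlgebra.map (Matrix.toLin' (sectorAnalysisMatrix L M β (klAnisoFamily L M β μ K klE0 J))) T) 2 X‖ ≤ B) :
    imagTimeWeight β M *
      ∑ x ∈ (univ : Finset (Fin 2 → SpaceTimeIdx L M)).filter (fun x => x 0 = x₀), ∑ ω' : Fin (sectorCount J),
        imagTimeWeight β M * (circDist (2 * M) (x 0).1.val (x 1).1.val : ℝ) *
          ‖sectorisedKernel L M β (klAnisoFamily L M β μ K klE0 J) T 2
              (![((ω, σ), 0), ((ω', σ), 1)] : Fin 2 → SectorLeg (sectorCount J)) x‖ ≤ (klScale klE0 j)⁻¹ * B := by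
  have hε := imagTimeWeight_nonneg hβ M
  have hinv : 0 ≤ (klScale klE0 j)⁻¹ := inv_nonneg.2 (klth_klScale_pos j).le
  set g : (Fin 2 → SpaceTimeIdx L M × SectorLeg (sectorCount J)) → ℝ := fun X =>
    (klScale klE0 j)⁻¹ * (klScaleWt L M β j ((univ.image X).image (latticeLegPos (2 * (2 * M)))) - 1) *
      ‖kernel ℂ (ExteriorAlgebra.map (Matrix.toLin' (sectorAnalysisMatrix L M β (klAnisoFamily L M β μ K klE0 J))) T) 2 X‖ with hg
  have hg0 : ∀ X, 0 ≤ g X := fun X =>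
    mul_nonneg (mul_nonneg hinv (by have := one_le_klScaleWt L M β j ((univ.image X).image (latticeLegPos (2 * (2 * M)))); linarith))
      (norm_nonneg _)
  -- termwise domination of the time weight, then the fibre domination
  have hdom : ∑ x ∈ (univ : Finset (Fin 2 → SpaceTimeIdx L M)).filter (fun x => x 0 = x₀), ∑ ω' : Fin (sectorCount J),
        imagTimeWeight β M * (circDist (2 * M) (x 0).1.val (x 1).1.val : ℝ) *
          ‖sectorisedKernel L M β (klAnisoFamily L M β μ K klE0 J) T 2
              (![((ω, σ), 0), ((ω', σ), 1)] : Fin 2 → SectorLeg (sectorCount J)) x‖ ≤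
      ∑ x ∈ (univ : Finset (Fin 2 → SpaceTimeIdx L M)).filter (fun x => x 0 = x₀), ∑ ω' : Fin (sectorCount J),
        g (fun i => (x i, (![((ω, σ), 0), ((ω', σ), 1)] : Fin 2 → SectorLeg (sectorCount J)) i)) := by
    refine sum_le_sum fun x _ => sum_le_sum fun ω' _ => ?_
    rw [hg]
    dsimp only
    rw [kernel_map_sectorAnalysis_string]
    refine mul_le_mul_of_nonneg_right ?_ (norm_nonneg _)
    exact timeWeight_le_klScale_inv_mul_klScaleWt_sub_one hβ j
      (fun i => (x i, (![((ω, σ), 0), ((ω', σ), 1)] : Fin 2 → SectorLeg (sectorCount J)) i))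
  have hfib := sum_sector_string_le_sum_pinned g hg0 σ ω x₀
  have hsum : ∑ X ∈ univ.filter (fun X : Fin 2 → SpaceTimeIdx L M × SectorLeg (sectorCount J) => X 0 = (x₀, ((ω, σ), 0))), g X =
      (klScale klE0 j)⁻¹ * ∑ X ∈ univ.filter (fun X : Fin 2 → SpaceTimeIdx L M × SectorLeg (sectorCount J) => X 0 = (x₀, ((ω, σ), 0))),
        (klScaleWt L M β j ((univ.image X).image (latticeLegPos (2 * (2 * M)))) - 1) *
          ‖kernel ℂ (ExteriorAlgebra.map (Matrix.toLin' (sectorAnalysisMatrix L M β (klAnisoFamily L M β μ K klE0 J))) T) 2 X‖ := by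
    rw [mul_sum]; exact sum_congr rfl fun X _ => by rw [hg]; ring
  calc imagTimeWeight β M * _ ≤ imagTimeWeight β M * ∑ X ∈ univ.filter
          (fun X : Fin 2 → SpaceTimeIdx L M × SectorLeg (sectorCount J) => X 0 = (x₀, ((ω, σ), 0))), g X :=
        mul_le_mul_of_nonneg_left (hdom.trans hfib) hε
    _ = (klScale klE0 j)⁻¹ * (imagTimeWeight β M * ∑ X ∈ univ.filter
          (fun X : Fin 2 → SpaceTimeIdx L M × SectorLeg (sectorCount J) => X 0 = (x₀, ((ω, σ), 0))),
        (klScaleWt L M β j ((univ.image X).image (latticeLegPos (2 * (2 * M)))) - 1) *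
          ‖kernel ℂ (ExteriorAlgebra.map (Matrix.toLin' (sectorAnalysisMatrix L M β (klAnisoFamily L M β μ K klE0 J))) T) 2 X‖) := by
        rw [hsum]; ring
    _ ≤ (klScale klE0 j)⁻¹ * B := mul_le_mul_of_nonneg_left hB hinv

/-- **SPACE ROW FROM THE `(klScaleWt_j − 1)`-WEIGHTED SECTOR-PINNED SUM** (`0 ≤ β`): the same hypothesis gives the atom's space expression at
`(σ, ω, x₀)` `≤ 2Λ_j⁻¹·B`. [cite: BenfattoGiulianiMastropietro2006, §3 (3.5)-(3.6)] -/
theorem sectorSpaceMoment_le_of_wtSubOne_pinnedSum (hβ : 0 ≤ β)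
    (hB : imagTimeWeight β M *
      ∑ X ∈ univ.filter (fun X : Fin 2 → SpaceTimeIdx L M × SectorLeg (sectorCount J) => X 0 = (x₀, ((ω, σ), 0))),
        (klScaleWt L M β j ((univ.image X).image (latticeLegPos (2 * (2 * M)))) - 1) *
          ‖kernel ℂ (ExteriorAlgebra.map (Matrix.toLin' (sectorAnalysisMatrix L M β (klAnisoFamily L M β μ K klE0 J))) T) 2 X‖ ≤ B) :
    imagTimeWeight β M *
      ∑ x ∈ (univ : Finset (Fin 2 → SpaceTimeIdx L M)).filter (fun x => x 0 = x₀), ∑ ω' : Fin (sectorCount J),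
        (|((((x 0).2 - (x 1).2) 0).valMinAbs : ℝ)| + |((((x 0).2 - (x 1).2) 1).valMinAbs : ℝ)|) *
          ‖sectorisedKernel L M β (klAnisoFamily L M β μ K klE0 J) T 2
              (![((ω, σ), 0), ((ω', σ), 1)] : Fin 2 → SectorLeg (sectorCount J)) x‖ ≤ 2 * (klScale klE0 j)⁻¹ * B := by
  have hε := imagTimeWeight_nonneg hβ M
  have hinv : 0 ≤ (klScale klE0 j)⁻¹ := inv_nonneg.2 (klth_klScale_pos j).le
  set g : (Fin 2 → SpaceTimeIdx L M × SectorLeg (sectorCount J)) → ℝ := fun X =>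
    2 * ((klScale klE0 j)⁻¹ * (klScaleWt L M β j ((univ.image X).image (latticeLegPos (2 * (2 * M)))) - 1)) *
      ‖kernel ℂ (ExteriorAlgebra.map (Matrix.toLin' (sectorAnalysisMatrix L M β (klAnisoFamily L M β μ K klE0 J))) T) 2 X‖ with hg
  have hg0 : ∀ X, 0 ≤ g X := fun X =>
    mul_nonneg (mul_nonneg zero_le_two (mul_nonneg hinv
      (by have := one_le_klScaleWt L M β j ((univ.image X).image (latticeLegPos (2 * (2 * M)))); linarith))) (norm_nonneg _)
  have hdom : ∑ x ∈ (univ : Finset (Fin 2 → SpaceTimeIdx L M)).filter (fun x => x 0 = x₀), ∑ ω' : Fin (sectorCount J),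
        (|((((x 0).2 - (x 1).2) 0).valMinAbs : ℝ)| + |((((x 0).2 - (x 1).2) 1).valMinAbs : ℝ)|) *
          ‖sectorisedKernel L M β (klAnisoFamily L M β μ K klE0 J) T 2
              (![((ω, σ), 0), ((ω', σ), 1)] : Fin 2 → SectorLeg (sectorCount J)) x‖ ≤
      ∑ x ∈ (univ : Finset (Fin 2 → SpaceTimeIdx L M)).filter (fun x => x 0 = x₀), ∑ ω' : Fin (sectorCount J),
        g (fun i => (x i, (![((ω, σ), 0), ((ω', σ), 1)] : Fin 2 → SectorLeg (sectorCount J)) i)) := by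
    refine sum_le_sum fun x _ => sum_le_sum fun ω' _ => ?_
    rw [hg]
    dsimp only
    rw [kernel_map_sectorAnalysis_string]
    refine mul_le_mul_of_nonneg_right ?_ (norm_nonneg _)
    exact spaceWeight_le_two_mul_klScale_inv_mul_klScaleWt_sub_one hβ j
      (fun i => (x i, (![((ω, σ), 0), ((ω', σ), 1)] : Fin 2 → SectorLeg (sectorCount J)) i))
  have hfib := sum_sector_string_le_sum_pinned g hg0 σ ω x₀
  have hsum : ∑ X ∈ univ.filter (fun X : Fin 2 → SpaceTimeIdx L M × SectorLeg (sectorCount J) => X 0 = (x₀, ((ω, σ), 0))), g X =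
      2 * (klScale klE0 j)⁻¹ * ∑ X ∈ univ.filter (fun X : Fin 2 → SpaceTimeIdx L M × SectorLeg (sectorCount J) => X 0 = (x₀, ((ω, σ), 0))),
        (klScaleWt L M β j ((univ.image X).image (latticeLegPos (2 * (2 * M)))) - 1) *
          ‖kernel ℂ (ExteriorAlgebra.map (Matrix.toLin' (sectorAnalysisMatrix L M β (klAnisoFamily L M β μ K klE0 J))) T) 2 X‖ := by
    rw [mul_sum]; exact sum_congr rfl fun X _ => by rw [hg]; ring
  calc imagTimeWeight β M * _ ≤ imagTimeWeight β M * ∑ X ∈ univ.filter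
          (fun X : Fin 2 → SpaceTimeIdx L M × SectorLeg (sectorCount J) => X 0 = (x₀, ((ω, σ), 0))), g X :=
        mul_le_mul_of_nonneg_left (hdom.trans hfib) hε
    _ = 2 * (klScale klE0 j)⁻¹ * (imagTimeWeight β M * ∑ X ∈ univ.filter
          (fun X : Fin 2 → SpaceTimeIdx L M × SectorLeg (sectorCount J) => X 0 = (x₀, ((ω, σ), 0))),
        (klScaleWt L M β j ((univ.image X).image (latticeLegPos (2 * (2 * M)))) - 1) *
          ‖kernel ℂ (ExteriorAlgebra.map (Matrix.toLin' (sectorAnalysisMatrix L M β (klAnisoFamily L M β μ K klE0 J))) T) 2 X‖) := by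
        rw [hsum]; ring
    _ ≤ 2 * (klScale klE0 j)⁻¹ * B := mul_le_mul_of_nonneg_left hB (mul_nonneg zero_le_two hinv)

omit [NeZero M] in
/-- The `(klScaleWt − 1)`-weighted sector-pinned sum is at most the tower's carrier `klWtPinnedSumAt … J j 2 T 0 w`. -/
theorem wtSubOne_pinnedSum_le_klWtPinnedSumAt (hβ : 0 ≤ β) (μ : ℝ) (K : TrigPolyC4v) (J j : ℕ) (T : HubbardGrassmann L M)
    (w : SpaceTimeIdx L M × SectorLeg (sectorCount J)) :
    imagTimeWeight β M *
      ∑ X ∈ univ.filter (fun X : Fin 2 → SpaceTimeIdx L M × SectorLeg (sectorCount J) => X 0 = w),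
        (klScaleWt L M β j ((univ.image X).image (latticeLegPos (2 * (2 * M)))) - 1) *
          ‖kernel ℂ (ExteriorAlgebra.map (Matrix.toLin' (sectorAnalysisMatrix L M β (klAnisoFamily L M β μ K klE0 J))) T) 2 X‖ ≤
      klWtPinnedSumAt L M β μ K J j 2 T 0 w := by
  rw [klWtPinnedSumAt, show (2 - 1 : ℕ) = 1 from rfl, pow_one]
  exact mul_le_mul_of_nonneg_left (sum_le_sum fun X _ => klScaleWt_sub_one_mul_le β j _ (norm_nonneg _)) (imagTimeWeight_nonneg hβ M)

/-- **TIME ROW FROM THE TOWER'S CARRIER**: `klWtPinnedSumAt L M β μ K J j 2 T 0 (x₀, ((ω,σ),+)) ≤ B` ⇒ the atom's time expression `≤ Λ_j⁻¹·B` (`0 ≤ β`).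
[cite: BenfattoGiulianiMastropietro2006, §3 (3.5)-(3.6)] -/
theorem sectorTimeMoment_le_of_klWtPinnedSumAt (hβ : 0 ≤ β) (hB : klWtPinnedSumAt L M β μ K J j 2 T 0 (x₀, ((ω, σ), 0)) ≤ B) :
    imagTimeWeight β M *
      ∑ x ∈ (univ : Finset (Fin 2 → SpaceTimeIdx L M)).filter (fun x => x 0 = x₀), ∑ ω' : Fin (sectorCount J),
        imagTimeWeight β M * (circDist (2 * M) (x 0).1.val (x 1).1.val : ℝ) *
          ‖sectorisedKernel L M β (klAnisoFamily L M β μ K klE0 J) T 2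
              (![((ω, σ), 0), ((ω', σ), 1)] : Fin 2 → SectorLeg (sectorCount J)) x‖ ≤ (klScale klE0 j)⁻¹ * B :=
  sectorTimeMoment_le_of_wtSubOne_pinnedSum hβ ((wtSubOne_pinnedSum_le_klWtPinnedSumAt hβ μ K J j T _).trans hB)

/-- **SPACE ROW FROM THE TOWER'S CARRIER**: `klWtPinnedSumAt L M β μ K J j 2 T 0 (x₀, ((ω,σ),+)) ≤ B` ⇒ the atom's space expression `≤ 2Λ_j⁻¹·B` (`0 ≤ β`).
[cite: BenfattoGiulianiMastropietro2006, §3 (3.5)-(3.6)] -/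
theorem sectorSpaceMoment_le_of_klWtPinnedSumAt (hβ : 0 ≤ β) (hB : klWtPinnedSumAt L M β μ K J j 2 T 0 (x₀, ((ω, σ), 0)) ≤ B) :
    imagTimeWeight β M *
      ∑ x ∈ (univ : Finset (Fin 2 → SpaceTimeIdx L M)).filter (fun x => x 0 = x₀), ∑ ω' : Fin (sectorCount J),
        (|((((x 0).2 - (x 1).2) 0).valMinAbs : ℝ)| + |((((x 0).2 - (x 1).2) 1).valMinAbs : ℝ)|) *
          ‖sectorisedKernel L M β (klAnisoFamily L M β μ K klE0 J) T 2
              (![((ω, σ), 0), ((ω', σ), 1)] : Fin 2 → SectorLeg (sectorCount J)) x‖ ≤ 2 * (klScale klE0 j)⁻¹ * B :=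
  sectorSpaceMoment_le_of_wtSubOne_pinnedSum hβ ((wtSubOne_pinnedSum_le_klWtPinnedSumAt hβ μ K J j T _).trans hB)

end Rows

/-! ## §4 The fixed-tuple first-moment door (any family, any degree) — route (M)'s M2 at every resolution by the same weight domination

(Appended by hubbard-kl-k3c2-p3 g9, pen (R81b) question «does W3's carrier give the `m > n` moments by the same door?»: YES up to the carrier's shape —
M2 reads a FIXED iso tuple of the QUARTIC, so the supplier's natural datum is the `(klScaleWt_r − 1)`- or `klScaleWt_r`-weighted FIXED-TUPLE sum below,
for ANY family `F` (iso of any resolution `m` included) and rate `r`; the conversion is `Λ_r·spaceTimeDist ≤ klScaleWt_r − 1` again.) -/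

section FixedTuple

variable {N : ℕ} {β : ℝ} {F : Fin N → FreqMomentum L M → ℂ} {G : HubbardGrassmann L M} {r m : ℕ} {Ω : Fin (m + 1) → SectorLeg N}
  {x₁ : SpaceTimeIdx L M} {B : ℝ}

/-- **FIXED-TUPLE FIRST MOMENT FROM THE `(klScaleWt_r − 1)`-WEIGHTED FIXED-TUPLE SUM** (`0 ≤ β`; any family `F`, element `G`, degree `m + 1`, tuple `Ω`, pin `x₁`,
legs `i, k`): if `ε^m Σ_y (klScaleWt_r(positions of x₁::y) − 1)·‖W^F_{m+1,Ω}(G)(x₁::y)‖ ≤ B` then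
`Λ_r · ε^m Σ_y spaceTimeDist((x₁::y) i, (x₁::y) k)·‖W^F_{m+1,Ω}(G)(x₁::y)‖ ≤ B`. [cite: BenfattoGiulianiMastropietro2006, §3 (3.5)-(3.6)] -/
theorem fixedTuple_firstMoment_le_of_wtSubOne (hβ : 0 ≤ β) (i k : Fin (m + 1))
    (hB : imagTimeWeight β M ^ m * ∑ y : Fin m → SpaceTimeIdx L M,
      (klScaleWt L M β r ((univ.image (fun l => (Matrix.vecCons x₁ y l, Ω l))).image (latticeLegPos (2 * (2 * M)))) - 1) *
        ‖sectorisedKernel L M β F G (m + 1) Ω (Matrix.vecCons x₁ y)‖ ≤ B) :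
    klScale klE0 r * (imagTimeWeight β M ^ m * ∑ y : Fin m → SpaceTimeIdx L M,
      KLRegimeSplit.spaceTimeDist L M β (Matrix.vecCons x₁ y i) (Matrix.vecCons x₁ y k) *
        ‖sectorisedKernel L M β F G (m + 1) Ω (Matrix.vecCons x₁ y)‖) ≤ B := by
  have hε : 0 ≤ imagTimeWeight β M ^ m := pow_nonneg (imagTimeWeight_nonneg hβ M) m
  rw [mul_left_comm, mul_sum]
  refine le_trans (mul_le_mul_of_nonneg_left (sum_le_sum fun y _ => ?_) hε) hB
  rw [← mul_assoc]
  refine mul_le_mul_of_nonneg_right ?_ (norm_nonneg _)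
  have h := klScale_mul_spaceTimeDist_le_klScaleWt_image_sub_one (L := L) (M := M) hβ r
    (fun l : Fin (m + 1) => (Matrix.vecCons x₁ y l, Ω l)) i k
  exact h

/-- The same from the `klScaleWt_r`-weighted fixed-tuple sum (`klScaleWt − 1 ≤ klScaleWt`). -/
theorem fixedTuple_firstMoment_le_of_wt (hβ : 0 ≤ β) (i k : Fin (m + 1))
    (hB : imagTimeWeight β M ^ m * ∑ y : Fin m → SpaceTimeIdx L M,
      klScaleWt L M β r ((univ.image (fun l => (Matrix.vecCons x₁ y l, Ω l))).image (latticeLegPos (2 * (2 * M)))) *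
        ‖sectorisedKernel L M β F G (m + 1) Ω (Matrix.vecCons x₁ y)‖ ≤ B) :
    klScale klE0 r * (imagTimeWeight β M ^ m * ∑ y : Fin m → SpaceTimeIdx L M,
      KLRegimeSplit.spaceTimeDist L M β (Matrix.vecCons x₁ y i) (Matrix.vecCons x₁ y k) *
        ‖sectorisedKernel L M β F G (m + 1) Ω (Matrix.vecCons x₁ y)‖) ≤ B := by
  refine fixedTuple_firstMoment_le_of_wtSubOne hβ i k (le_trans ?_ hB)
  exact mul_le_mul_of_nonneg_left (sum_le_sum fun y _ => klScaleWt_sub_one_mul_le β r _ (norm_nonneg _))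
    (pow_nonneg (imagTimeWeight_nonneg hβ M) m)

end FixedTuple

/-- **M2's LITERAL SHAPE (route (M), every resolution `m`)**: for the iso-sectorised quartic `klIsoKernelAt … K n m` of `𝒱_n[K]` at resolution `m`, any tuple `Ω`,
pin `x₁`, leg `j`: a `klScaleWt_m`-weighted fixed-tuple sum `≤ X` gives `Λ_m · ε³ Σ_y spaceTimeDist(x₁, y j)·‖W(x₁::y)‖ ≤ X`.
[cite: BenfattoGiulianiMastropietro2006, §3 (3.5)-(3.6)] -/
theorem klIso_firstMoment_le_of_wt {β : ℝ} (hβ : 0 ≤ β) (U μ : ℝ) (K : TrigPolyC4v) (n m : ℕ) (Ω : Fin 4 → SectorLeg (sectorCount (2 * m)))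
    (x₁ : SpaceTimeIdx L M) (j : Fin 3) {X : ℝ}
    (hX : imagTimeWeight β M ^ 3 * ∑ y : Fin 3 → SpaceTimeIdx L M,
      klScaleWt L M β m ((univ.image (fun l => (Matrix.vecCons x₁ y l, Ω l))).image (latticeLegPos (2 * (2 * M)))) *
        ‖klIsoKernelAt L M β U μ K n m Ω (Matrix.vecCons x₁ y)‖ ≤ X) :
    klScale klE0 m * (imagTimeWeight β M ^ 3 * ∑ y : Fin 3 → SpaceTimeIdx L M,
      KLRegimeSplit.spaceTimeDist L M β x₁ (y j) * ‖klIsoKernelAt L M β U μ K n m Ω (Matrix.vecCons x₁ y)‖) ≤ X := by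
  have h := fixedTuple_firstMoment_le_of_wt (L := L) (M := M) (F := klIsoFamily L M β μ K klE0 m)
    (G := klEffectiveAction L M β U μ K klE0 n) (Ω := Ω) (x₁ := x₁) hβ (0 : Fin 4) j.succ hX
  simpa only [klIsoKernelAt, Matrix.cons_val_zero, Matrix.cons_val_succ] using h

end Summit.HubbardSuperconductivity.HubbardSuperconductivity.Theorems.EngineV8

end
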